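import Literature.Topology.FourManifolds.SphereImmersionNormalField
import Literature.Topology.FourManifolds.SphereMapsMissPoints
import Literature.Topology.FourManifolds.DisjunctionLemma
import HarnessLib

/-!
# The normal tube of a compact manifold embedded in a round sphere: nearest points

Topic `Literature/Topology/FourManifolds`; third file of the generalisation of the tree's 2-knot
pipeline (Kirby, *The Topology of 4-Manifolds* (1989), Ch. VIII, Thm. 2) from the round `S²`
(`TwoKnotNormalTube.lean`) to an **abstract compact manifold** `M` smoothly embedded in a round
sphere, `f : M → 𝕊ᴺ`. The tubular neighbourhood itself is the tree's
`Literature.Topology.FourManifolds.exists_isOpen_normalTube_contMDiffOn` (`NormalRetraction.lean`,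
Hirsch, *Differential Topology* (1976), Ch. 4 §5, Thm. 5.1: normal radius, open normal tube and
smooth normal retraction `r` of an injective immersion of a compact manifold into an inner product
space); this file adds what Kirby's transport argument (`TwoKnotNormalEuler.lean`) consumes:

* `forall_inner_ambientDeriv_eq_zero_of_isMinOn` — **a nearest image point is the foot of a
  normal** (first-order condition along chart curves);
* `IsSphereTubeRadius n f ε` — `ε` is a normal radius of `ι ∘ f` with open tube and smooth retraction —
  and `exists_isSphereTubeRadius`; within such a radius the retraction `nearPt n f ε = r` is the
  nearest-point map on the metric tube `{z | dist (z, f M) < ε}` (`norm_sub_nearPt`,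
  `forall_inner_ambientDeriv_nearPt`, `nearPt_coe`, `continuousOn_nearPt`), exactly the interface of
  `TwoKnotNormalSection.nearPt` / `IsInjRadius`;
* `exists_notMem_range_neg_notMem_range` — a smooth map `M → 𝕊ᴺ` from a second countable
  `n`-manifold with `n < N` misses a pair of antipodal points (Hausdorff dimension, as in
  `SphereMapsMissPoints.lean` for maps of spheres).

Everything is proved; no named facts are introduced (D-0026).

## References

* R. C. Kirby, *The Topology of 4-Manifolds*, LNM 1374, Springer (1989), Ch. VIII, Thm. 2 and its
  proof, pp. 44–45. [Kirby1989]
* M. W. Hirsch, *Differential Topology*, GTM 33 (1976), Ch. 4 §5, Thm. 5.1 (tubular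
  neighbourhoods); Ch. 3 §1, Prop. 1.2 (images of lower-dimensional manifolds). [HirschDT1976]
-/

open scoped Manifold ContDiff Topology RealInnerProductSpace ENNReal
open Set Function Module Filter Metric

noncomputable section

namespace Literature.Topology.FourManifolds

/-- Local notation: `𝔼 n` is the model Euclidean space `EuclideanSpace ℝ (Fin n)`. -/
local notation "𝔼 " n:arg => EuclideanSpace ℝ (Fin n)

/-- Local notation: `𝕊 n` is the unit sphere in `EuclideanSpace ℝ (Fin (n + 1))`. -/
local notation "𝕊 " n:arg => (Metric.sphere (0 : EuclideanSpace ℝ (Fin (n + 1))) 1)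

attribute [local instance] fact_finrank_euclideanSpace_succ

variable {n N : ℕ} {M : Type*} [TopologicalSpace M] [ChartedSpace (𝔼 n) M] {f : M → 𝕊 N}

/-! ### The image and nearest points -/

variable (f) in
/-- The image `f(M) ⊆ ℝᴺ⁺¹`. [folklore] -/
def img : Set (𝔼 (N + 1)) := range (sphCoe f)

omit [TopologicalSpace M] [ChartedSpace (𝔼 n) M] in
/-- Image points have distance `0` to the image. [folklore] -/
theorem infDist_coe_img (x : M) : infDist (f x : 𝔼 (N + 1)) (img f) = 0 :=
  infDist_zero_of_mem ⟨x, rfl⟩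

/-- The image of a compact manifold is compact. [folklore] -/
theorem isCompact_img [CompactSpace M] (hcont : Continuous f) : IsCompact (img f) :=
  isCompact_range (continuous_subtype_val.comp hcont)

/-- **Nearest image points exist** (compactness). [folklore] -/
theorem exists_forall_norm_sub_le [CompactSpace M] [Nonempty M] (hcont : Continuous f)
    (z : 𝔼 (N + 1)) : ∃ x₀ : M, ∀ x : M, ‖z - f x₀‖ ≤ ‖z - f x‖ := by
  have hc : Continuous fun x : M => ‖z - (f x : 𝔼 (N + 1))‖ :=
    (continuous_const.sub (continuous_subtype_val.comp hcont)).norm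
  obtain ⟨x₀, -, hx₀⟩ := isCompact_univ.exists_isMinOn univ_nonempty hc.continuousOn
  exact ⟨x₀, fun x => hx₀ (mem_univ x)⟩

/-- The distance from `z` to a nearest point is the distance to the image. [folklore] -/
theorem norm_sub_eq_infDist_of_forall_le [CompactSpace M] (hcont : Continuous f) {z : 𝔼 (N + 1)}
    {x₀ : M} (hmin : ∀ x : M, ‖z - f x₀‖ ≤ ‖z - f x‖) : ‖z - f x₀‖ = infDist z (img f) := by
  haveI : Nonempty M := ⟨x₀⟩
  obtain ⟨_, ⟨x₁, rfl⟩, h⟩ := (isCompact_img hcont).exists_infDist_eq_dist (range_nonempty _) z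
  refine le_antisymm ?_ ?_
  · rw [h, dist_eq_norm]
    exact hmin x₁
  · rw [← dist_eq_norm]
    exact infDist_le_dist_of_mem ⟨x₀, rfl⟩

section Foot

variable [IsManifold (𝓡 n) ∞ M] (hf : ContMDiff (𝓡 n) (𝓡 N) ∞ f)
include hf

/-- **A nearest image point is the foot of a normal**: if `x₀` minimises `‖z - f x‖` then `z` is
orthogonal to the tangent plane at `x₀` (first-order condition along the chart curves
`t ↦ φ⁻¹ (φ x₀ + t v)`). [folklore] -/
theorem forall_inner_ambientDeriv_eq_zero_of_isMinOn (x₀ : M) (z : 𝔼 (N + 1))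
    (hmin : ∀ x : M, ‖z - f x₀‖ ≤ ‖z - f x‖) (v : 𝔼 n) : ⟪z, ambientDeriv (𝓡 n) f x₀ v⟫ = 0 := by
  have he := contMDiff_sphCoe hf
  have hx₀ : x₀ ∈ (extChartAt (𝓡 n) x₀).source := mem_extChartAt_source x₀
  -- it suffices to treat the chart derivative
  suffices key : ∀ u : 𝔼 n,
      ⟪z - f x₀, chartDeriv (𝓡 n) (sphCoe f) x₀ (extChartAt (𝓡 n) x₀ x₀) u⟫ = 0 by
    have h1 : ambientDeriv (𝓡 n) f x₀ v = chartDeriv (𝓡 n) (sphCoe f) x₀ (extChartAt (𝓡 n) x₀ x₀)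
        (mfderiv (𝓡 n) 𝓘(ℝ, 𝔼 n) (extChartAt (𝓡 n) x₀) x₀ v) := by
      have h := mfderiv_eq_chartDeriv_comp (I := 𝓡 n) (e := sphCoe f) hx₀
        ((he x₀).mdifferentiableAt (by simp))
      exact DFunLike.congr_fun h v
    have h2 := key (mfderiv (𝓡 n) 𝓘(ℝ, 𝔼 n) (extChartAt (𝓡 n) x₀) x₀ v)
    rw [← h1, inner_sub_left, inner_coe_ambientDeriv hf, sub_zero] at h2
    exact h2
  intro u
  -- the chart curve and the squared distance along it
  set g : 𝔼 n → 𝔼 (N + 1) := sphCoe f ∘ (extChartAt (𝓡 n) x₀).symm with hg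
  have hg0 : g (extChartAt (𝓡 n) x₀ x₀) = f x₀ := by
    simp [hg, sphCoe]
  set ψ : ℝ → ℝ := fun t => ‖z - g (extChartAt (𝓡 n) x₀ x₀ + t • u)‖ ^ 2 with hψ
  have hloc : IsLocalMin ψ 0 := by
    refine Filter.Eventually.of_forall fun t => ?_
    change ‖z - g (extChartAt (𝓡 n) x₀ x₀ + (0 : ℝ) • u)‖ ^ 2 ≤
      ‖z - g (extChartAt (𝓡 n) x₀ x₀ + t • u)‖ ^ 2
    rw [zero_smul, add_zero, hg0]
    exact pow_le_pow_left₀ (norm_nonneg _) (hmin _) 2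
  have hcurve : HasDerivAt (fun t : ℝ => extChartAt (𝓡 n) x₀ x₀ + t • u) u 0 := by
    simpa using ((hasDerivAt_id (0 : ℝ)).smul_const u).const_add (extChartAt (𝓡 n) x₀ x₀)
  have hG : HasFDerivAt g (chartDeriv (𝓡 n) (sphCoe f) x₀ (extChartAt (𝓡 n) x₀ x₀))
      (extChartAt (𝓡 n) x₀ x₀ + (0 : ℝ) • u) := by
    rw [zero_smul, add_zero]
    exact hasFDerivAt_comp_extChartAt_symm he x₀ ((extChartAt (𝓡 n) x₀).map_source hx₀)
  have hcomp : HasDerivAt (fun t : ℝ => z - g (extChartAt (𝓡 n) x₀ x₀ + t • u))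
      (-(chartDeriv (𝓡 n) (sphCoe f) x₀ (extChartAt (𝓡 n) x₀ x₀) u)) 0 := by
    simpa using (hG.comp_hasDerivAt (0 : ℝ) hcurve).const_sub z
  have hd : HasDerivAt ψ (2 * ⟪z - g (extChartAt (𝓡 n) x₀ x₀ + (0 : ℝ) • u),
      -(chartDeriv (𝓡 n) (sphCoe f) x₀ (extChartAt (𝓡 n) x₀ x₀) u)⟫) 0 := hcomp.norm_sq
  have h := hloc.hasDerivAt_eq_zero hd
  rw [zero_smul, add_zero, hg0, inner_neg_right] at h
  linarith

/-- A nearest point decomposes `z` as image point plus normal vector (tree's `normalSpace`).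
[folklore] -/
theorem sub_mem_normalSpace_of_isMinOn (x₀ : M) (z : 𝔼 (N + 1))
    (hmin : ∀ x : M, ‖z - f x₀‖ ≤ ‖z - f x‖) :
    z - (f x₀ : 𝔼 (N + 1)) ∈ normalSpace (𝓡 n) (sphCoe f) x₀ := by
  rw [← forall_inner_ambientDeriv_eq_zero_iff_mem_normalSpace]
  intro v
  rw [inner_sub_left, forall_inner_ambientDeriv_eq_zero_of_isMinOn hf x₀ z hmin v,
    inner_coe_ambientDeriv hf, sub_zero]

end Foot

/-! ### Tube radii and the nearest-point retraction -/

variable (n f) in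
/-- `IsSphereTubeRadius n f ε`: `ε` is a normal radius of `ι ∘ f` (tree's `IsNormalRadius`) whose normal
tube is open with the normal retraction `C^∞` on it — the output of the tree's tubular
neighbourhood theorem `exists_isOpen_normalTube_contMDiffOn`. [cite: HirschDT1976, Ch. 4 §5 Thm. 5.1] -/
def IsSphereTubeRadius [Nonempty M] (ε : ℝ) : Prop :=
  IsNormalRadius (𝓡 n) (sphCoe f) ε ∧ IsOpen (normalTube (𝓡 n) (sphCoe f) ε) ∧
    ContMDiffOn 𝓘(ℝ, 𝔼 (N + 1)) (𝓡 n) ∞ (normalRetraction (𝓡 n) (sphCoe f) ε)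
      (normalTube (𝓡 n) (sphCoe f) ε)

variable (n f) in
/-- The **nearest-point map** of the tube of radius `ε`: the tree's normal retraction of `ι ∘ f`.
[folklore] -/
abbrev nearPt [Nonempty M] (ε : ℝ) (z : 𝔼 (N + 1)) : M := normalRetraction (𝓡 n) (sphCoe f) ε z

section Tube

variable [IsManifold (𝓡 n) ∞ M] [CompactSpace M] [Nonempty M]
  (hf : ContMDiff (𝓡 n) (𝓡 N) ∞ f)
include hf

/-- **A smooth embedding of a compact manifold into a round sphere has a tube radius** (tree's
tubular neighbourhood theorem). [cite: HirschDT1976, Ch. 4 §5 Thm. 5.1] -/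
theorem exists_isSphereTubeRadius (hf' : ∀ x, Injective (mfderiv (𝓡 n) (𝓡 N) f x)) (hinj : Injective f) :
    ∃ ε, IsSphereTubeRadius n f ε := by
  have hinje : Injective (sphCoe f) := fun x y h => hinj (Subtype.ext h)
  obtain ⟨ε, hε, hopen, hsmooth⟩ := exists_isOpen_normalTube_contMDiffOn (I := 𝓡 n)
    (contMDiff_sphCoe hf) hinje (fun x => injective_ambientDeriv hf (hf' x))
  exact ⟨ε, hε, hopen, hsmooth⟩

omit [IsManifold (𝓡 n) ∞ M] [CompactSpace M] hf in
/-- A tube radius is positive. [folklore] -/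
theorem IsSphereTubeRadius.pos {ε : ℝ} (h : IsSphereTubeRadius n f ε) : 0 < ε := h.1.1

/-- **Points of the metric tube are endpoints of short normals from their nearest points**: for
`dist (z, f M) < ε` and a nearest point `x₀`, `z ∈` the normal tube and `nearPt n f ε z = x₀`.
[folklore] -/
theorem nearPt_eq_of_isMinOn {ε : ℝ} (hε : IsSphereTubeRadius n f ε) {z : 𝔼 (N + 1)}
    (hz : infDist z (img f) < ε) {x₀ : M} (hmin : ∀ x : M, ‖z - f x₀‖ ≤ ‖z - f x‖) :
    z ∈ normalTube (𝓡 n) (sphCoe f) ε ∧ nearPt n f ε z = x₀ := by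
  have hv : z - (f x₀ : 𝔼 (N + 1)) ∈ normalSpace (𝓡 n) (sphCoe f) x₀ :=
    sub_mem_normalSpace_of_isMinOn hf x₀ z hmin
  have hvε : ‖z - (f x₀ : 𝔼 (N + 1))‖ < ε := by
    rwa [norm_sub_eq_infDist_of_forall_le hf.continuous hmin]
  have hz' : z = sphCoe f x₀ + (z - (f x₀ : 𝔼 (N + 1))) := by simp [sphCoe]
  refine ⟨hz' ▸ add_mem_normalTube hv hvε, ?_⟩
  rw [nearPt, hz']
  exact normalRetraction_add hε.1 hv hvε

/-- **Within a tube radius the retraction is the nearest point**: `‖z - f (nearPt z)‖ = dist (z, f M)`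
on the metric tube. [folklore] -/
theorem norm_sub_nearPt {ε : ℝ} (hε : IsSphereTubeRadius n f ε) {z : 𝔼 (N + 1)} (hz : infDist z (img f) < ε) :
    ‖z - f (nearPt n f ε z)‖ = infDist z (img f) := by
  obtain ⟨x₀, hmin⟩ := exists_forall_norm_sub_le hf.continuous z
  rw [(nearPt_eq_of_isMinOn hf hε hz hmin).2]
  exact norm_sub_eq_infDist_of_forall_le hf.continuous hmin

/-- Within a tube radius, `nearPt z` minimises the distance from `z`. [folklore] -/
theorem norm_sub_nearPt_le {ε : ℝ} (hε : IsSphereTubeRadius n f ε) {z : 𝔼 (N + 1)}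
    (hz : infDist z (img f) < ε) (x : M) : ‖z - f (nearPt n f ε z)‖ ≤ ‖z - f x‖ := by
  rw [norm_sub_nearPt hf hε hz, ← dist_eq_norm]
  exact infDist_le_dist_of_mem ⟨x, rfl⟩

/-- **`z` is normal to `f` at its nearest point** (within a tube radius). [folklore] -/
theorem forall_inner_ambientDeriv_nearPt {ε : ℝ} (hε : IsSphereTubeRadius n f ε) {z : 𝔼 (N + 1)}
    (hz : infDist z (img f) < ε) (v : 𝔼 n) : ⟪z, ambientDeriv (𝓡 n) f (nearPt n f ε z) v⟫ = 0 :=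
  forall_inner_ambientDeriv_eq_zero_of_isMinOn hf _ z (norm_sub_nearPt_le hf hε hz) v

/-- Points of the metric tube lie in the normal tube. [folklore] -/
theorem mem_normalTube_of_infDist_lt {ε : ℝ} (hε : IsSphereTubeRadius n f ε) {z : 𝔼 (N + 1)}
    (hz : infDist z (img f) < ε) : z ∈ normalTube (𝓡 n) (sphCoe f) ε := by
  obtain ⟨x₀, hmin⟩ := exists_forall_norm_sub_le hf.continuous z
  exact (nearPt_eq_of_isMinOn hf hε hz hmin).1

omit [IsManifold (𝓡 n) ∞ M] [CompactSpace M] hf in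
/-- The nearest point of an image point is its preimage. [folklore] -/
theorem nearPt_coe {ε : ℝ} (hε : IsSphereTubeRadius n f ε) (x : M) : nearPt n f ε (f x) = x :=
  normalRetraction_apply_self hε.1 x

omit [IsManifold (𝓡 n) ∞ M] [CompactSpace M] in
/-- **Uniqueness of feet within a tube radius**: a foot of a normal from `z` of length `< ε` is the
nearest point. [folklore] -/
theorem eq_nearPt_of_forall_inner {ε : ℝ} (hε : IsSphereTubeRadius n f ε) {x : M} {z : 𝔼 (N + 1)}
    (hn : ∀ v, ⟪z, ambientDeriv (𝓡 n) f x v⟫ = 0) (hz : ‖z - f x‖ < ε) : nearPt n f ε z = x := by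
  have hv : z - (f x : 𝔼 (N + 1)) ∈ normalSpace (𝓡 n) (sphCoe f) x := by
    rw [← forall_inner_ambientDeriv_eq_zero_iff_mem_normalSpace]
    intro v
    rw [inner_sub_left, hn v, inner_coe_ambientDeriv hf, sub_zero]
  have hz' : z = sphCoe f x + (z - (f x : 𝔼 (N + 1))) := by simp [sphCoe]
  rw [nearPt, hz']
  exact normalRetraction_add hε.1 hv hz

/-- **Continuity of the nearest-point map on the metric tube** (it is even `C^∞` there, being the
normal retraction on a subset of the open normal tube). [folklore] -/
theorem continuousOn_nearPt {ε : ℝ} (hε : IsSphereTubeRadius n f ε) :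
    ContinuousOn (nearPt n f ε) {z | infDist z (img f) < ε} :=
  hε.2.2.continuousOn.mono fun _ hz => mem_normalTube_of_infDist_lt hf hε hz

/-- The nearest-point map is smooth on the metric tube. [folklore] -/
theorem contMDiffOn_nearPt {ε : ℝ} (hε : IsSphereTubeRadius n f ε) :
    ContMDiffOn 𝓘(ℝ, 𝔼 (N + 1)) (𝓡 n) ∞ (nearPt n f ε) {z | infDist z (img f) < ε} :=
  hε.2.2.mono fun _ hz => mem_normalTube_of_infDist_lt hf hε hz

end Tube

/-! ### Base points off the image -/

/-- **A smooth map `M → 𝕊ᴺ` from an `n`-manifold with `n < N` misses a pair of antipodal points**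
(images of lower-dimensional manifolds have Hausdorff dimension `≤ n < N ≤ dim (𝕊ᴺ ∖ pt)`; the
tree's `dimH_range_le_finrank_of_contMDiff`, Hirsch Ch. 3 §1 Prop. 1.2).
[cite: HirschDT1976, Ch. 3 §1 Prop. 1.2] -/
theorem exists_notMem_range_neg_notMem_range [IsManifold (𝓡 n) 1 M] [SecondCountableTopology M]
    (hnN : n < N) (hf : ContMDiff (𝓡 n) (𝓡 N) 1 f) : ∃ q : 𝕊 N, q ∉ range f ∧ -q ∉ range f := by
  by_contra! hsurj
  let v : 𝕊 N := spherePt N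
  set R : Set (𝔼 (N + 1)) := range fun x => (f x : 𝔼 (N + 1)) with hR
  have hdim : dimH R ≤ n := by
    have h := dimH_range_le_finrank_of_contMDiff (I := 𝓡 n) (contMDiff_coe_sphere.comp hf)
    rwa [finrank_euclideanSpace_fin] at h
  have h1 : (sphere (0 : 𝔼 (N + 1)) 1) \ {(v : 𝔼 (N + 1))} ⊆ R ∪ (LinearIsometryEquiv.neg ℝ) '' R := by
    rintro y ⟨hy, -⟩
    by_cases hyR : (⟨y, hy⟩ : 𝕊 N) ∈ range f
    · obtain ⟨x, hx⟩ := hyR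
      exact Or.inl ⟨x, by simp [hx]⟩
    · obtain ⟨x, hx⟩ := hsurj ⟨y, hy⟩ hyR
      refine Or.inr ⟨(f x : 𝔼 (N + 1)), ⟨x, rfl⟩, ?_⟩
      have : ((f x : 𝕊 N) : 𝔼 (N + 1)) = -y := by rw [hx]; rfl
      simp [LinearIsometryEquiv.coe_neg, this]
  have h2 : dimH ((LinearIsometryEquiv.neg ℝ) '' R) ≤ n := by
    rw [(LinearIsometryEquiv.neg ℝ (E := 𝔼 (N + 1))).isometry.dimH_image]
    exact hdim
  have := calc (N : ℝ≥0∞) ≤ dimH ((sphere (0 : 𝔼 (N + 1)) 1) \ {(v : 𝔼 (N + 1))}) :=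
          le_dimH_sphere_diff_singleton v
    _ ≤ dimH (R ∪ (LinearIsometryEquiv.neg ℝ) '' R) := dimH_mono h1
    _ = max (dimH R) (dimH ((LinearIsometryEquiv.neg ℝ) '' R)) := dimH_union _ _
    _ ≤ n := max_le hdim h2
  exact absurd (by exact_mod_cast this) (not_le.2 hnN)

end Literature.Topology.FourManifolds
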